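import Mathlib
import HarnessLib
import Summits.Ventures.LatticeQCDFlow.Exactness.UniformJitterLaw

/-!
# The code's `tau_jitter` law has NO ATOMS (every `tau_jitter ≠ 0`, `τ ≠ 0`): GEN-22's atom theorems are vacuous for the idealised engine law, its support is the length window, and it is absolutely continuous

HONEST FRAMING: exact (Metropolis-corrected) sampling algorithms for lattice gauge theory;
figures of merit are autocorrelation/cost numbers at stated couplings and volumes; no
continuum-physics claim.

Venture `LatticeQCDFlow` (cell pub-lqcd), topic `Exactness`, FANOUT row 9 (eng-latcore, GEN-24; the engine's
`hmc.HMC.trajectory(τ, nstep, tau_jitter = j)`: `tau_t = tau * (1 + tau_jitter * (2u − 1))`, `u` uniform on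
`[0, 1]`).  NEW WORK of the cell over GEN-24's `UniformJitterLaw.lean` (`uniformJitterLaw τ j` = the image of
`Leb|[0,1]` under the code's formula; `uniformJitterLaw_Icc`, `uniformJitterLaw_charges_short`) and Mathlib's
Lebesgue measure on `ℝ` (`Real.volume_preimage_mul_left`, translation invariance, singletons are null).  Nothing is
cited as a fact; no number is claimed.

WHY.  GEN-22 typed ergodicity of the jittered engine HMC through an ATOM of the jitter law
(`wilson_sunWilsonForceJitterHMC_uniformlyErgodic`: some label `e₀` with `η{e₀} ≠ 0` and a short step); GEN-24
replaced the atom by an interval of lengths of positive `η`-mass (`SUNLeapfrogHMCUniformMinorant`,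
`JitteredHMCCommonMinorant`).  This file records WHY the replacement is necessary and not a convenience: for every
`τ ≠ 0` and every `tau_jitter = j ≠ 0` the idealised engine law `uniformJitterLaw τ j` gives mass `0` to EVERY single
length — it has no atom at all (`nullSingletonClass_uniformJitterLaw`), so no atom theorem applies to it; what it does charge
is every sub-interval of its window (GEN-24 `uniformJitterLaw_Icc`).  It also records the window (the law lives on
`uIcc (τ(1−j)) (τ(1+j))`) and absolute continuity with respect to Lebesgue measure.

## Content (`τ j : ℝ`)

* **`uniformJitterLaw_apply_singleton`** — `τ·j ≠ 0` ⇒ `uniformJitterLaw τ j {a} = 0` for every `a`.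
* **`nullSingletonClass_uniformJitterLaw`** — `τ·j ≠ 0` ⇒ `NullSingletonClass (uniformJitterLaw τ j)` (no atoms); **`uniformJitterLaw_countable`** —
  hence every countable set of lengths (e.g. all floating-point numbers) is `η`-null: the idealised law and the
  53-bit law of the code as run are mutually singular idealisations, and only interval statements transfer.
* **`uniformJitterLaw_window_compl`**, **`uniformJitterLaw_window`** — the law gives mass `0` outside, and mass `1`
  to, the window `uIcc (τ(1−j)) (τ(1+j))` (any `τ`, `j`).
* **`uniformJitterLaw_le_volume`**, **`uniformJitterLaw_absolutelyContinuous`** — `τ·j ≠ 0` ⇒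
  `η(s) ≤ |2τj|⁻¹ · Leb(s)` for measurable `s`, hence `η ≪ Leb`.

NOT CLAIMED: anything about floating point beyond the remark; any dynamics (see `SUNJitteredHMCAtomless`).
-/

noncomputable section

namespace Summit.Ventures.LatticeQCDFlow.Exactness

open MeasureTheory Set
open scoped ENNReal

section Atomless

/-- The code's formula is the affine map `u ↦ τ(1−j) + (2τj)·u`. -/
theorem jitterFormula_eq_affine (τ j u : ℝ) : τ * (1 + j * (2 * u - 1)) = τ * (1 - j) + 2 * τ * j * u := by ring

/-- For `τ·j ≠ 0` the code's formula is injective. -/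
theorem jitterFormula_injective {τ j : ℝ} (h : τ * j ≠ 0) :
    Function.Injective fun u : ℝ => τ * (1 + j * (2 * u - 1)) := by
  intro u v huv
  have h2 : 2 * τ * j ≠ 0 := by
    rw [mul_assoc]; exact mul_ne_zero two_ne_zero h
  have : τ * (1 - j) + 2 * τ * j * u = τ * (1 - j) + 2 * τ * j * v := by
    simpa only [jitterFormula_eq_affine] using huv
  exact mul_left_cancel₀ h2 (add_left_cancel this)

/-- **EVERY SINGLE LENGTH HAS PROBABILITY ZERO** under the idealised engine law, as soon as `τ ≠ 0` and
`tau_jitter ≠ 0`. -/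
theorem uniformJitterLaw_apply_singleton {τ j : ℝ} (h : τ * j ≠ 0) (a : ℝ) : uniformJitterLaw τ j {a} = 0 := by
  rw [uniformJitterLaw, Measure.map_apply (measurable_jitterFormula τ j) (measurableSet_singleton a)]
  exact ((subsingleton_singleton (a := a)).preimage (jitterFormula_injective h)).measure_zero _

/-- **THE IDEALISED `tau_jitter` LAW HAS NO ATOMS** (`τ·j ≠ 0`; Mathlib's `NullSingletonClass`, the former `NoAtoms`):
GEN-22's atom route does not apply to it. -/
theorem nullSingletonClass_uniformJitterLaw {τ j : ℝ} (h : τ * j ≠ 0) : NullSingletonClass (uniformJitterLaw τ j) :=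
  ⟨uniformJitterLaw_apply_singleton h⟩

/-- Hence every countable set of lengths is null for it (e.g. the set of all floating-point numbers). -/
theorem uniformJitterLaw_countable {τ j : ℝ} (h : τ * j ≠ 0) {s : Set ℝ} (hs : s.Countable) :
    uniformJitterLaw τ j s = 0 := by
  haveI := nullSingletonClass_uniformJitterLaw h
  exact hs.measure_zero _

end Atomless

section Window

/-- For `u ∈ [0, 1]` the drawn length lies in the window `uIcc (τ(1−j)) (τ(1+j))` (a convex combination of its
ends). -/
theorem jitterFormula_mem_uIcc (τ j : ℝ) {u : ℝ} (hu0 : 0 ≤ u) (hu1 : u ≤ 1) :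
    τ * (1 + j * (2 * u - 1)) ∈ uIcc (τ * (1 - j)) (τ * (1 + j)) := by
  rw [jitterFormula_eq_affine]
  rcases le_total (τ * (1 - j)) (τ * (1 + j)) with hab | hab
  · rw [uIcc_of_le hab]; constructor <;> nlinarith
  · rw [uIcc_of_ge hab]; constructor <;> nlinarith

/-- **THE LAW LIVES ON THE LENGTH WINDOW**: mass `0` outside `uIcc (τ(1−j)) (τ(1+j))`, for every `τ` and `j`
(no sign or size condition). -/
theorem uniformJitterLaw_window_compl (τ j : ℝ) :
    uniformJitterLaw τ j (uIcc (τ * (1 - j)) (τ * (1 + j)))ᶜ = 0 := by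
  rw [uniformJitterLaw, Measure.map_apply (measurable_jitterFormula τ j) measurableSet_uIcc.compl,
    Measure.restrict_apply ((measurable_jitterFormula τ j) measurableSet_uIcc.compl)]
  exact measure_mono_null (fun u hu => (hu.1 (jitterFormula_mem_uIcc τ j hu.2.1 hu.2.2)).elim) measure_empty

/-- Hence the window carries all the mass: `η(uIcc (τ(1−j)) (τ(1+j))) = 1`. -/
theorem uniformJitterLaw_window (τ j : ℝ) : uniformJitterLaw τ j (uIcc (τ * (1 - j)) (τ * (1 + j))) = 1 := by
  have h := measure_add_measure_compl (μ := uniformJitterLaw τ j) (measurableSet_uIcc (a := τ * (1 - j)) (b := τ * (1 + j)))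
  rwa [uniformJitterLaw_window_compl, add_zero, measure_univ] at h

end Window

section AbsolutelyContinuous

/-- **DENSITY BOUND**: `η(s) ≤ |2τj|⁻¹ · Leb(s)` for every measurable `s` (`τ·j ≠ 0`) — the image of `Leb|[0,1]` under
the affine formula is at most the image of `Leb`, which is `|2τj|⁻¹ · Leb`. -/
theorem uniformJitterLaw_le_volume {τ j : ℝ} (h : τ * j ≠ 0) {s : Set ℝ} (hs : MeasurableSet s) :
    uniformJitterLaw τ j s ≤ ENNReal.ofReal |(2 * τ * j)⁻¹| * volume s := by
  have h2 : 2 * τ * j ≠ 0 := by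
    rw [mul_assoc]; exact mul_ne_zero two_ne_zero h
  rw [uniformJitterLaw, Measure.map_apply (measurable_jitterFormula τ j) hs,
    Measure.restrict_apply ((measurable_jitterFormula τ j) hs)]
  have hpre : (fun u : ℝ => τ * (1 + j * (2 * u - 1))) ⁻¹' s =
      (fun u : ℝ => 2 * τ * j * u) ⁻¹' ((fun v : ℝ => τ * (1 - j) + v) ⁻¹' s) := by
    ext u
    simp only [mem_preimage, jitterFormula_eq_affine]
  calc volume ((fun u : ℝ => τ * (1 + j * (2 * u - 1))) ⁻¹' s ∩ Icc 0 1)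
      ≤ volume ((fun u : ℝ => τ * (1 + j * (2 * u - 1))) ⁻¹' s) := measure_mono inter_subset_left
    _ = ENNReal.ofReal |(2 * τ * j)⁻¹| * volume s := by
        rw [hpre, Real.volume_preimage_mul_left h2, measure_preimage_add]

/-- **THE IDEALISED `tau_jitter` LAW IS ABSOLUTELY CONTINUOUS WITH RESPECT TO LEBESGUE MEASURE** (`τ·j ≠ 0`). -/
theorem uniformJitterLaw_absolutelyContinuous {τ j : ℝ} (h : τ * j ≠ 0) :
    uniformJitterLaw τ j ≪ (volume : Measure ℝ) := by
  refine Measure.AbsolutelyContinuous.mk fun s hs h0 => nonpos_iff_eq_zero.1 ?_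
  simpa only [h0, mul_zero] using uniformJitterLaw_le_volume h hs

end AbsolutelyContinuous

end Summit.Ventures.LatticeQCDFlow.Exactness

end
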